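import Summits.CriticalPhenomena.PercolationContinuityZ3.Theorems.PercNearOneGluingNoHeavyLowerTailSahiThreeCopyBlocks

/-!
# `NoHeavyLowerTail` (crux stmt-CriticalPhenomena-4575), Sahi programme: **3C-SAHI IS CLOSED UNDER BLOCKWISE MONOTONE
# SUBSTITUTION** — replacing a variable of `(f,g,h)` SIMULTANEOUSLY in all three functions by an arbitrary monotone Boolean
# function `σ` of a block of fresh variables maps every three-copy coefficient to a NONNEGATIVE combination of the old ones:
# `c_{(B₀,b)}(f∘Σ, g∘Σ, h∘Σ) = Σ_{k=0}^{3} m_k(B₀,σ) · c_{(k,b)}(f,g,h)`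

Support file (Sahi cell, seat `prim-sahi-p1`, generation 55; `--supports stmt-CriticalPhenomena-4575`); companion of `…SahiThreeCopy`
(generation 53) and `…SahiThreeCopyBlocks` (generation 54, whose `appendProf` — concatenated profiles — is reused).

THE OPERATION.  For `f : {0,1}^{d+1} → ℝ` (variable `x₀` and `d` further variables) and a Boolean function `σ : {0,1}^e → Bool` of a
fresh block of `e` variables, `subst e σ f : {0,1}^{d+e} → ℝ` is `(y, x) ↦ f(σ(y), x)` (block in front, defined by peeling front
coordinates like `tens`).  The SAME `σ` is substituted in all three slots; the outer triple `(f,g,h)` is arbitrary.  [Contrast: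
`…Blocks`/`…BlockOr` compose a FIXED outer gate (AND / OR) with slot-dependent inner triples.]

THE THEOREM (`tc_subst`).  For every block profile `B₀` and back profile `b`,
`c_{(B₀,b)}(subst σ f, subst σ g, subst σ h) = Σ_{k=0}^{3} m_k · c_{(k,b)}(f,g,h)` with the NONNEGATIVE INTEGERS
`m_k = #{block arrangements (y¹,y²,y³) of B₀ with (σy¹,σy²,σy³) = a fixed pattern of weight k}` (`bcount`; well defined because the
number of block arrangements with a given `σ`-pattern is a symmetric function of the pattern — swapping two copies is a bijection
of the arrangements of `B₀`, `bcount_swap12/23`).  Mechanism: the block slice recursion `N3_subst` (induction on `e` through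
`N3_cons`, with three possibly different inner functions `σ¹, σ², σ³` to make the induction go) expresses every `N_{(B₀,b)}` of
substituted functions as `Σ_{arr B₀} Φ(σy¹,σy²,σy³)` with `Φ(ε) = N_b(u^{ε₁};v^{ε₂};w^{ε₃})`; grouping by the pattern and using the
symmetry gives `Σ_k m_k Σ_{|ε|=k} Φ(ε) = Σ_k m_k N_{(k,b)}(u;v;w)` (`N3_cons`).  In probabilistic terms: given the block profile,
the induced triple of bits `(σy¹,σy²,σy³)` is EXCHANGEABLE, hence a mixture of the uniform laws on arrangements of `k = 0,…,3`
— 3C-SAHI is a statement about coordinatewise-exchangeable triples, and those are stable under blockwise maps.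
CONSEQUENCES: `tc_subst_nonneg` — if `c_{b'}(f,g,h) ≥ 0` for all profiles `b'` then `c_B(subst σ f, subst σ g, subst σ h) ≥ 0` for
all profiles `B` of `{0,1}^{d+e}`; with `subst_nonneg`, `subst_monotone` the class {nonnegative monotone triples satisfying 3C-SAHI
at every profile} is CLOSED UNDER BLOCKWISE MONOTONE SUBSTITUTION (`threeCopyGood_subst`); iterate (and permute coordinates) to
substitute every variable.  With `…SahiThreeCopyCubeFour` (3C-SAHI on `{0,1}^{≤4}`): every blockwise-monotone substitution instance
of a triple on `≤ 4` variables satisfies 3C-SAHI — e.g. `(σ₁∨σ₂σ₃, σ₂∨σ₄, σ₁σ₄∨σ₃)` for arbitrary monotone `σ_i` on disjoint blocks.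
At law level the closure is trivial (the push-forward of a product measure along a blockwise map is a product measure); the
coefficientwise statement is the content.  Nothing conjectural is used or asserted.  [this work]
-/

namespace Summit.CriticalPhenomena.PercolationContinuityZ3.Theorems.SahiThreeCopy

open Finset Function Literature.Combinatorics.Sahi2008
open scoped BigOperators

noncomputable section

variable {d : ℕ}

/-! ### §1 Blockwise substitution of the first variable -/

/-- `subst e σ f (y, x) = f(σ(y), x)`: the first variable of `f : {0,1}^{d+1} → ℝ` replaced by the Boolean function `σ` of a
fresh block of `e` front variables (defined by peeling front coordinates; `e = 0` fixes the variable to the constant `σ(∅)`). [this work] -/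
def subst : (e : ℕ) → (Pt e → Bool) → (Pt (d + 1) → ℝ) → (Pt (d + e) → ℝ)
  | 0, σ, f => sec f (σ fun i => Fin.elim0 i)
  | e + 1, σ, f => fun w => subst e (fun y => σ (Fin.cons (w 0) y)) f (Fin.tail w)

/-- Sections of a substituted function along the first block coordinate: restrict `σ`. [this work] -/
theorem sec_subst (e : ℕ) (σ : Pt (e + 1) → Bool) (f : Pt (d + 1) → ℝ) (ε : Bool) :
    sec (subst (e + 1) σ f) ε = subst e (fun y => σ (Fin.cons ε y)) f := by
  funext x; simp [sec, subst, Fin.cons_zero, Fin.tail_cons]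

/-- Substitution is multiplicative. [this work] -/
theorem subst_mul : ∀ (e : ℕ) (σ : Pt e → Bool) (f g : Pt (d + 1) → ℝ), subst e σ (f * g) = subst e σ f * subst e σ g
  | 0, σ, f, g => by funext x; rfl
  | e + 1, σ, f, g => by
    funext w
    have h := congrFun (subst_mul e (fun y => σ (Fin.cons (w 0) y)) f g) (Fin.tail w)
    simp only [Pi.mul_apply] at h
    simp only [subst, Pi.mul_apply]
    exact h

/-- Substitution fixes the constant `1`. [this work] -/
theorem subst_one : ∀ (e : ℕ) (σ : Pt e → Bool), subst e σ (1 : Pt (d + 1) → ℝ) = 1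
  | 0, σ => by funext x; rfl
  | e + 1, σ => by funext w; simp only [subst, subst_one e, Pi.one_apply]

/-- Substitution preserves nonnegativity. [this work] -/
theorem subst_nonneg : ∀ (e : ℕ) (σ : Pt e → Bool) {f : Pt (d + 1) → ℝ}, (∀ x, 0 ≤ f x) → ∀ w, 0 ≤ subst e σ f w
  | 0, _, _, hf, _ => hf _
  | e + 1, _, _, hf, _ => subst_nonneg e _ hf _

/-- Substitution is monotone in `σ` and in the point (auxiliary joint statement). [this work] -/
theorem subst_le_subst : ∀ (e : ℕ) {σ σ' : Pt e → Bool} {f : Pt (d + 1) → ℝ}, (∀ y, σ y ≤ σ' y) → Monotone σ' → Monotone f →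
    ∀ {w w' : Pt (d + e)}, w ≤ w' → subst e σ f w ≤ subst e σ' f w'
  | 0, σ, σ', f, hσ, _, hf, w, w', hww' => by
    simp only [subst, sec]
    exact hf (Fin.cons_le_cons.2 ⟨hσ _, hww'⟩)
  | e + 1, σ, σ', f, hσ, hσ'm, hf, w, w', hww' => by
    simp only [subst]
    refine subst_le_subst e (fun y => ?_) (fun y y' hyy' => hσ'm (Fin.cons_le_cons.2 ⟨le_rfl, hyy'⟩)) hf
      (fun i => hww' i.succ)
    exact (hσ _).trans (hσ'm (Fin.cons_le_cons.2 ⟨hww' 0, le_rfl⟩))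

/-- Substitution of a monotone `σ` into a monotone `f` is monotone. [this work] -/
theorem subst_monotone (e : ℕ) {σ : Pt e → Bool} {f : Pt (d + 1) → ℝ} (hσ : Monotone σ) (hf : Monotone f) :
    Monotone (subst e σ f) :=
  fun _ _ hww' => subst_le_subst e (fun _ => le_rfl) hσ hf hww'

/-! ### §2 The block slice recursion -/

/-- The BLOCK SUM of a pattern function: `Σ_{(y¹,y²,y³) arrangement of B₀} Φ(σ¹y¹, σ²y², σ³y³)`. [this work] -/
def bsum (e : ℕ) (B₀ : Fin e → ℕ) (σ₁ σ₂ σ₃ : Pt e → Bool) (Φ : Bool → Bool → Bool → ℝ) : ℝ :=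
  ∑ y₁ : Pt e, ∑ y₂ : Pt e, ∑ y₃ : Pt e, if IsArr B₀ y₁ y₂ y₃ then Φ (σ₁ y₁) (σ₂ y₂) (σ₃ y₃) else 0

/-- Block sum over the empty block: one (empty) arrangement. [this work] -/
theorem bsum_zero (B₀ : Fin 0 → ℕ) (σ₁ σ₂ σ₃ : Pt 0 → Bool) (Φ : Bool → Bool → Bool → ℝ) :
    bsum 0 B₀ σ₁ σ₂ σ₃ Φ = Φ (σ₁ fun i => Fin.elim0 i) (σ₂ fun i => Fin.elim0 i) (σ₃ fun i => Fin.elim0 i) := by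
  have key : ∀ y₁ y₂ y₃ : Pt 0, (if IsArr B₀ y₁ y₂ y₃ then Φ (σ₁ y₁) (σ₂ y₂) (σ₃ y₃) else 0) =
      Φ (σ₁ fun i => Fin.elim0 i) (σ₂ fun i => Fin.elim0 i) (σ₃ fun i => Fin.elim0 i) := by
    intro y₁ y₂ y₃
    have h1 : y₁ = fun i => Fin.elim0 i := Subsingleton.elim _ _
    have h2 : y₂ = fun i => Fin.elim0 i := Subsingleton.elim _ _
    have h3 : y₃ = fun i => Fin.elim0 i := Subsingleton.elim _ _
    subst h1 h2 h3
    exact if_pos (fun i => Fin.elim0 i)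
  unfold bsum
  rw [Fintype.sum_unique, Fintype.sum_unique, Fintype.sum_unique]
  exact key _ _ _

/-- Block sum recursion along the first block coordinate. [this work] -/
theorem bsum_succ (e : ℕ) (k : ℕ) (B₀ : Fin e → ℕ) (σ₁ σ₂ σ₃ : Pt (e + 1) → Bool) (Φ : Bool → Bool → Bool → ℝ) :
    bsum (e + 1) (Fin.cons k B₀) σ₁ σ₂ σ₃ Φ =
      ∑ ε₁ : Bool, ∑ ε₂ : Bool, ∑ ε₃ : Bool, if ε₁.toNat + ε₂.toNat + ε₃.toNat = k then
        bsum e B₀ (fun y => σ₁ (Fin.cons ε₁ y)) (fun y => σ₂ (Fin.cons ε₂ y)) (fun y => σ₃ (Fin.cons ε₃ y)) Φ else 0 := by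
  unfold bsum
  simp only [sum_pt_succ, ite_isArr_cons]
  refine (sum6_comm _).trans ?_
  refine sum_congr rfl fun ε₁ _ => sum_congr rfl fun ε₂ _ => sum_congr rfl fun ε₃ _ => ?_
  by_cases hc : ε₁.toNat + ε₂.toNat + ε₃.toNat = k
  · simp only [hc, true_and, if_true]
  · simp only [hc, false_and, if_false, sum_const_zero]

/-- ★ **Block slice recursion**: with three (possibly different) inner functions,
`N_{(B₀,b)}(subst σ¹ u; subst σ² v; subst σ³ w) = Σ_{arr B₀} N_b(u^{σ¹y¹}; v^{σ²y²}; w^{σ³y³})`. [this work] -/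
theorem N3_subst : ∀ (e : ℕ) (B₀ : Fin e → ℕ) (b : Fin d → ℕ) (σ₁ σ₂ σ₃ : Pt e → Bool) (u v w : Pt (d + 1) → ℝ),
    N3 (appendProf e B₀ b) (subst e σ₁ u) (subst e σ₂ v) (subst e σ₃ w) =
      bsum e B₀ σ₁ σ₂ σ₃ fun ε₁ ε₂ ε₃ => N3 b (sec u ε₁) (sec v ε₂) (sec w ε₃)
  | 0, B₀, b, σ₁, σ₂, σ₃, u, v, w => by
    rw [bsum_zero]; rfl
  | e + 1, B₀, b, σ₁, σ₂, σ₃, u, v, w => by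
    have hB : B₀ = Fin.cons (B₀ 0) (Fin.tail B₀) := (Fin.cons_self_tail B₀).symm
    conv_rhs => rw [hB, bsum_succ]
    simp only [appendProf]
    rw [N3_cons]
    simp only [sec_subst, N3_subst e]

/-! ### §3 Exchangeability of the induced pattern: the counts `m_k` -/

/-- The number of block arrangements of `B₀` whose `σ`-pattern is `(ε₁,ε₂,ε₃)` (as a real number). [this work] -/
def bcount (e : ℕ) (B₀ : Fin e → ℕ) (σ : Pt e → Bool) (ε₁ ε₂ ε₃ : Bool) : ℝ :=
  bsum e B₀ σ σ σ fun a₁ a₂ a₃ => if a₁ = ε₁ ∧ a₂ = ε₂ ∧ a₃ = ε₃ then 1 else 0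

/-- Pattern counts are nonnegative. [this work] -/
theorem bcount_nonneg (e : ℕ) (B₀ : Fin e → ℕ) (σ : Pt e → Bool) (ε₁ ε₂ ε₃ : Bool) : 0 ≤ bcount e B₀ σ ε₁ ε₂ ε₃ := by
  simp only [bcount, bsum]
  refine sum_nonneg fun y₁ _ => sum_nonneg fun y₂ _ => sum_nonneg fun y₃ _ => ?_
  split_ifs <;> norm_num

/-- The block sum is the pattern-count-weighted sum of the eight pattern values. [this work] -/
theorem bsum_expand (e : ℕ) (B₀ : Fin e → ℕ) (σ : Pt e → Bool) (Φ : Bool → Bool → Bool → ℝ) :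
    bsum e B₀ σ σ σ Φ =
      bcount e B₀ σ false false false * Φ false false false + bcount e B₀ σ true false false * Φ true false false
      + bcount e B₀ σ false true false * Φ false true false + bcount e B₀ σ false false true * Φ false false true
      + bcount e B₀ σ false true true * Φ false true true + bcount e B₀ σ true false true * Φ true false true
      + bcount e B₀ σ true true false * Φ true true false + bcount e B₀ σ true true true * Φ true true true := by
  unfold bcount bsum
  simp only [Finset.sum_mul, ← Finset.sum_add_distrib]
  refine sum_congr rfl fun y₁ _ => sum_congr rfl fun y₂ _ => sum_congr rfl fun y₃ _ => ?_
  by_cases hA : IsArr B₀ y₁ y₂ y₃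
  · simp only [hA, if_true]
    cases σ y₁ <;> cases σ y₂ <;> cases σ y₃ <;> simp
  · simp only [hA, if_false, zero_mul, add_zero]

/-- Swapping the first two copies is a symmetry of the block arrangements. [this work] -/
theorem bsum_swap12 (e : ℕ) (B₀ : Fin e → ℕ) (σ₁ σ₂ σ₃ : Pt e → Bool) (Φ : Bool → Bool → Bool → ℝ) :
    bsum e B₀ σ₁ σ₂ σ₃ Φ = bsum e B₀ σ₂ σ₁ σ₃ fun a₁ a₂ a₃ => Φ a₂ a₁ a₃ := by
  unfold bsum
  rw [sum_comm]
  refine sum_congr rfl fun y₂ _ => sum_congr rfl fun y₁ _ => sum_congr rfl fun y₃ _ => ?_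
  have : IsArr B₀ y₁ y₂ y₃ ↔ IsArr B₀ y₂ y₁ y₃ := by
    unfold IsArr; exact forall_congr' fun i => by constructor <;> intro h <;> omega
  simp only [this]

/-- Swapping the last two copies is a symmetry of the block arrangements. [this work] -/
theorem bsum_swap23 (e : ℕ) (B₀ : Fin e → ℕ) (σ₁ σ₂ σ₃ : Pt e → Bool) (Φ : Bool → Bool → Bool → ℝ) :
    bsum e B₀ σ₁ σ₂ σ₃ Φ = bsum e B₀ σ₁ σ₃ σ₂ fun a₁ a₂ a₃ => Φ a₁ a₃ a₂ := by
  unfold bsum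
  refine sum_congr rfl fun y₁ _ => ?_
  rw [sum_comm]
  refine sum_congr rfl fun y₃ _ => sum_congr rfl fun y₂ _ => ?_
  have : IsArr B₀ y₁ y₂ y₃ ↔ IsArr B₀ y₁ y₃ y₂ := by
    unfold IsArr; exact forall_congr' fun i => by constructor <;> intro h <;> omega
  simp only [this]

/-- Pattern counts are symmetric under swapping the first two entries. [this work] -/
theorem bcount_swap12 (e : ℕ) (B₀ : Fin e → ℕ) (σ : Pt e → Bool) (ε₁ ε₂ ε₃ : Bool) :
    bcount e B₀ σ ε₁ ε₂ ε₃ = bcount e B₀ σ ε₂ ε₁ ε₃ := by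
  unfold bcount
  rw [bsum_swap12]
  congr 1; funext a₁ a₂ a₃
  simp only [and_left_comm]

/-- Pattern counts are symmetric under swapping the last two entries. [this work] -/
theorem bcount_swap23 (e : ℕ) (B₀ : Fin e → ℕ) (σ : Pt e → Bool) (ε₁ ε₂ ε₃ : Bool) :
    bcount e B₀ σ ε₁ ε₂ ε₃ = bcount e B₀ σ ε₁ ε₃ ε₂ := by
  unfold bcount
  rw [bsum_swap23]
  congr 1; funext a₁ a₂ a₃
  exact if_congr (by tauto) rfl rfl

/-- ★ **Exchangeability**: the block sum of any pattern function is `Σ_k m_k · Σ_{|ε|=k} Φ(ε)` with the four counts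
`m₀ = #(fff), m₁ = #(tff), m₂ = #(ttf), m₃ = #(ttt)`. [this work] -/
theorem bsum_eq_counts (e : ℕ) (B₀ : Fin e → ℕ) (σ : Pt e → Bool) (Φ : Bool → Bool → Bool → ℝ) :
    bsum e B₀ σ σ σ Φ =
      bcount e B₀ σ false false false * Φ false false false
      + bcount e B₀ σ true false false * (Φ true false false + Φ false true false + Φ false false true)
      + bcount e B₀ σ true true false * (Φ false true true + Φ true false true + Φ true true false)
      + bcount e B₀ σ true true true * Φ true true true := by
  rw [bsum_expand]
  have h1 : bcount e B₀ σ false true false = bcount e B₀ σ true false false := bcount_swap12 _ _ _ _ _ _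
  have h2 : bcount e B₀ σ false false true = bcount e B₀ σ true false false := by
    rw [bcount_swap23, bcount_swap12]
  have h3 : bcount e B₀ σ true false true = bcount e B₀ σ true true false := bcount_swap23 _ _ _ _ _ _
  have h4 : bcount e B₀ σ false true true = bcount e B₀ σ true true false := by
    rw [bcount_swap12, bcount_swap23]
  rw [h1, h2, h3, h4]
  ring

/-! ### §4 The substitution formula for `N_b` and for `c_b` -/

/-- `N_{(B₀,b)}(subst σ u; subst σ v; subst σ w) = Σ_k m_k · N_{(k,b)}(u;v;w)`. [this work] -/
theorem N3_subst_eq_counts (e : ℕ) (B₀ : Fin e → ℕ) (b : Fin d → ℕ) (σ : Pt e → Bool) (u v w : Pt (d + 1) → ℝ) :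
    N3 (appendProf e B₀ b) (subst e σ u) (subst e σ v) (subst e σ w) =
      bcount e B₀ σ false false false * N3 (Fin.cons 0 b : Fin (d + 1) → ℕ) u v w
      + bcount e B₀ σ true false false * N3 (Fin.cons 1 b : Fin (d + 1) → ℕ) u v w
      + bcount e B₀ σ true true false * N3 (Fin.cons 2 b : Fin (d + 1) → ℕ) u v w
      + bcount e B₀ σ true true true * N3 (Fin.cons 3 b : Fin (d + 1) → ℕ) u v w := by
  rw [N3_subst, bsum_eq_counts, N3_cons_zero, N3_cons_one, N3_cons_two, N3_cons_three]

/-- ★★ **The substitution formula for the three-copy Sahi coefficient**: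
`c_{(B₀,b)}(subst σ f, subst σ g, subst σ h) = Σ_{k=0}^{3} m_k(B₀,σ) · c_{(k,b)}(f,g,h)` with nonnegative `m_k`. [this work] -/
theorem tc_subst (e : ℕ) (B₀ : Fin e → ℕ) (b : Fin d → ℕ) (σ : Pt e → Bool) (f g h : Pt (d + 1) → ℝ) :
    tc (appendProf e B₀ b) (subst e σ f) (subst e σ g) (subst e σ h) =
      bcount e B₀ σ false false false * tc (Fin.cons 0 b : Fin (d + 1) → ℕ) f g h
      + bcount e B₀ σ true false false * tc (Fin.cons 1 b : Fin (d + 1) → ℕ) f g h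
      + bcount e B₀ σ true true false * tc (Fin.cons 2 b : Fin (d + 1) → ℕ) f g h
      + bcount e B₀ σ true true true * tc (Fin.cons 3 b : Fin (d + 1) → ℕ) f g h := by
  unfold tc
  rw [← subst_mul e σ f g, ← subst_mul e σ (f * g) h, ← subst_mul e σ g h, ← subst_mul e σ f h, ← subst_one e σ]
  simp only [N3_subst_eq_counts]
  ring

/-- ★★ **Closure of 3C-SAHI under blockwise substitution (concatenated profiles)**: if `c_{b'}(f,g,h) ≥ 0` for every profile
`b'` of `{0,1}^{d+1}`, then `c_{(B₀,b)}(subst σ f, subst σ g, subst σ h) ≥ 0`. [this work] -/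
theorem tc_subst_nonneg (e : ℕ) (B₀ : Fin e → ℕ) (b : Fin d → ℕ) (σ : Pt e → Bool) {f g h : Pt (d + 1) → ℝ}
    (H : ∀ b' : Fin (d + 1) → ℕ, 0 ≤ tc b' f g h) :
    0 ≤ tc (appendProf e B₀ b) (subst e σ f) (subst e σ g) (subst e σ h) := by
  rw [tc_subst]
  have := bcount_nonneg e B₀ σ
  refine add_nonneg (add_nonneg (add_nonneg ?_ ?_) ?_) ?_ <;> exact mul_nonneg (this _ _ _) (H _)

/-- The same at EVERY profile of `{0,1}^{d+e}` (every profile is a concatenation). [this work] -/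
theorem tc_subst_nonneg_all (e : ℕ) (σ : Pt e → Bool) {f g h : Pt (d + 1) → ℝ} (H : ∀ b' : Fin (d + 1) → ℕ, 0 ≤ tc b' f g h)
    (B : Fin (d + e) → ℕ) : 0 ≤ tc B (subst e σ f) (subst e σ g) (subst e σ h) := by
  obtain ⟨B₀, b, rfl⟩ := exists_appendProf e B
  exact tc_subst_nonneg e B₀ b σ H

/-! ### §5 The good class is closed under substitution -/

/-- A triple is 3C-GOOD: nonnegative, monotone, and `c_b ≥ 0` at every profile. [this work] -/
def ThreeCopyGood {n : ℕ} (f g h : Pt n → ℝ) : Prop :=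
  (∀ x, 0 ≤ f x) ∧ (∀ x, 0 ≤ g x) ∧ (∀ x, 0 ≤ h x) ∧ Monotone f ∧ Monotone g ∧ Monotone h ∧ ∀ b : Fin n → ℕ, 0 ≤ tc b f g h

/-- ★★ **3C-GOOD triples are closed under blockwise monotone substitution of the first variable**: for every monotone
`σ : {0,1}^e → Bool`, `(f,g,h)` good on `{0,1}^{d+1}` ⇒ `(subst σ f, subst σ g, subst σ h)` good on `{0,1}^{d+e}`.  (Other variables:
conjugate by a coordinate permutation; iterate to substitute every variable by its own block function.) [this work] -/
theorem threeCopyGood_subst (e : ℕ) {σ : Pt e → Bool} (hσ : Monotone σ) {f g h : Pt (d + 1) → ℝ} (H : ThreeCopyGood f g h) :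
    ThreeCopyGood (subst e σ f) (subst e σ g) (subst e σ h) := by
  obtain ⟨hf, hg, hh, hfm, hgm, hhm, htc⟩ := H
  exact ⟨subst_nonneg e σ hf, subst_nonneg e σ hg, subst_nonneg e σ hh, subst_monotone e hσ hfm, subst_monotone e hσ hgm,
    subst_monotone e hσ hhm, tc_subst_nonneg_all e σ htc⟩

/-- Under 3C-SAHI every nonnegative monotone triple is good (so the closure theorem is a genuine reduction tool: it transfers
the conjecture from `{0,1}^{d+1}` to all its substitution instances). [this work] -/
theorem threeCopyGood_of_threeCopySahi (H : ThreeCopySahi) {n : ℕ} {f g h : Pt n → ℝ} (hf : ∀ x, 0 ≤ f x) (hg : ∀ x, 0 ≤ g x)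
    (hh : ∀ x, 0 ≤ h x) (hfm : Monotone f) (hgm : Monotone g) (hhm : Monotone h) : ThreeCopyGood f g h :=
  ⟨hf, hg, hh, hfm, hgm, hhm, fun b => H n b f g h hf hg hh hfm hgm hhm⟩

end

end Summit.CriticalPhenomena.PercolationContinuityZ3.Theorems.SahiThreeCopy
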